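import Mathlib
import Summits.Ventures.PercRepro2.V2SP
import Summits.Ventures.PercRepro2.Tail2DPathFlip
import Summits.Ventures.PercRepro2.Tail2DTailAvg

/-!
# Blue paths are principal upper sets: the per-path decomposition of the blue-path mass
(seat mine-b, cell pub-perc-repro2; MINE-B.md §40.7)

The s–t paths of a pattern are the blue paths of the all-blue configuration (`Path s`); a blue path of a
configuration `x` is such a path all of whose edges are blue in `x` (`toPath`, injective), and «all edges of
`p` blue in `x`» is the order relation `pathConf s p ≤ x` with `pathConf s p` the configuration whose blue edges
are exactly those of `p` (`toPath_le`, `exists_toPath_of_le`).  Hence the blue-path count is the number of paths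
below `x` (`card_bluePaths_eq_card_paths_le`) and the blue-path mass of a tail is the sum over the paths of the
PRINCIPAL-UPPER-SET tail counts `upTail s (pathConf s p) a c = #{x ≥ pathConf s p : r ≥ a, b ≥ c}`
(`tailPaths_eq_sum_upTail`).  Consequences: the full-mask member (PM) `P(A,C) ≤ P(C,A)`, `A ≥ C+1`, of the
masked family follows from the per-path statement (PP′) — the same inequality for each principal upper set
`{x ≥ pathConf s p}` (`tailPaths_le_mirror_of_upTail`); `upTail` multiplies under series composition
(`upTail_ser`) and fibres under parallel composition (`upTail_par`), so the principal-upper-set form of the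
lane's family has the same series/parallel calculus as the counts.
-/

namespace Summit.Ventures.PercRepro2.Tail2D

open V2Closure

section Paths

/-- the all-blue configuration -/
def allBlue : ∀ s : SP, s.Conf
  | .free => true
  | .pin => ()
  | .absent => ()
  | .ser s t => (allBlue s, allBlue t)
  | .par s t => (allBlue s, allBlue t)

/-- the all-red configuration -/
def allRed : ∀ s : SP, s.Conf
  | .free => false
  | .pin => ()
  | .absent => ()
  | .ser s t => (allRed s, allRed t)
  | .par s t => (allRed s, allRed t)

/-- the configuration order is decidable (componentwise) -/
@[reducible] def confDecLE : ∀ s : SP, DecidableRel (α := s.Conf) (· ≤ ·)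
  | .free => fun x y => match x, y with
      | false, y => isTrue (show (false : Bool) ≤ y from Bool.false_le y)
      | true, true => isTrue le_rfl
      | true, false => isFalse (fun h => absurd (show (true : Bool) ≤ false from h) (by decide))
  | .pin => fun _ _ => isTrue le_rfl
  | .absent => fun _ _ => isTrue le_rfl
  | .ser s t => fun x y =>
      let _ := confDecLE s
      let _ := confDecLE t
      decidable_of_iff (x.1 ≤ y.1 ∧ x.2 ≤ y.2) Prod.le_def.symm
  | .par s t => fun x y =>
      let _ := confDecLE s
      let _ := confDecLE t
      decidable_of_iff (x.1 ≤ y.1 ∧ x.2 ≤ y.2) Prod.le_def.symm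

/-- decidability of the configuration order, as an instance -/
instance (s : SP) : DecidableRel (α := s.Conf) (· ≤ ·) := confDecLE s

/-- the s–t paths of a pattern: the blue paths of the all-blue configuration -/
abbrev Path (s : SP) : Type := bluePaths s (allBlue s)

/-- the configuration whose blue edges are exactly the edges of a path -/
def pathConf : ∀ (s : SP), Path s → s.Conf
  | .free, _ => true
  | .pin, q => q.elim
  | .absent, q => q.elim
  | .ser s t, q => (pathConf s q.1, pathConf t q.2)
  | .par s _, .inl q => (pathConf s q, allRed _)
  | .par _ t, .inr q => (allRed _, pathConf t q)

/-- a blue path of a configuration, as a path of the pattern -/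
def toPath : ∀ (s : SP) (x : s.Conf), bluePaths s x → Path s
  | .free, x, q => ⟨0, by
      cases x
      · exact absurd q.2 (by simp)
      · simp [allBlue]⟩
  | .pin, _, q => q.elim
  | .absent, _, q => q.elim
  | .ser s t, x, q => (toPath s x.1 q.1, toPath t x.2 q.2)
  | .par s _, x, .inl q => .inl (toPath s x.1 q)
  | .par _ t, x, .inr q => .inr (toPath t x.2 q)

/-- the all-red configuration is the bottom of the configuration order -/
theorem allRed_le : ∀ (s : SP) (x : s.Conf), allRed s ≤ x
  | .free, x => by
      show (false : Bool) ≤ x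
      exact Bool.false_le x
  | .pin, _ => le_rfl
  | .absent, _ => le_rfl
  | .ser s t, x => Prod.mk_le_mk.2 ⟨allRed_le s x.1, allRed_le t x.2⟩
  | .par s t, x => Prod.mk_le_mk.2 ⟨allRed_le s x.1, allRed_le t x.2⟩

/-- the path configuration of a blue path of `x` lies below `x` -/
theorem toPath_le : ∀ (s : SP) (x : s.Conf) (q : bluePaths s x), pathConf s (toPath s x q) ≤ x
  | .free, x, q => by
      cases x
      · exact absurd q.2 (by simp)
      · exact le_rfl
  | .pin, _, q => q.elim
  | .absent, _, q => q.elim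
  | .ser s t, x, q => Prod.mk_le_mk.2 ⟨toPath_le s x.1 q.1, toPath_le t x.2 q.2⟩
  | .par s t, x, .inl q => Prod.mk_le_mk.2 ⟨toPath_le s x.1 q, allRed_le t x.2⟩
  | .par s t, x, .inr q => Prod.mk_le_mk.2 ⟨allRed_le s x.1, toPath_le t x.2 q⟩

/-- `toPath` is injective -/
theorem toPath_injective : ∀ (s : SP) (x : s.Conf), Function.Injective (toPath s x)
  | .free, x, q, q', _ => by
      cases x
      · exact absurd q.2 (by simp)
      · have h1 : q.val < 1 := q.2
        have h2 : q'.val < 1 := q'.2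
        exact Fin.ext (by omega)
  | .pin, _, q, _, _ => q.elim
  | .absent, _, q, _, _ => q.elim
  | .ser s t, x, q, q', h => by
      simp only [toPath] at h
      obtain ⟨h1, h2⟩ := Prod.mk.inj h
      exact Prod.ext (toPath_injective s x.1 h1) (toPath_injective t x.2 h2)
  | .par s t, x, .inl q, .inl q', h => by
      simp only [toPath] at h
      exact congrArg Sum.inl (toPath_injective s x.1 (Sum.inl.inj h))
  | .par s t, x, .inl q, .inr q', h => by simp [toPath] at h
  | .par s t, x, .inr q, .inl q', h => by simp [toPath] at h
  | .par s t, x, .inr q, .inr q', h => by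
      simp only [toPath] at h
      exact congrArg Sum.inr (toPath_injective t x.2 (Sum.inr.inj h))

/-- a path below `x` is a blue path of `x` -/
theorem exists_toPath_of_le : ∀ (s : SP) (x : s.Conf) (p : Path s), pathConf s p ≤ x → ∃ q : bluePaths s x, toPath s x q = p
  | .free, x, p, h => by
      cases x
      · have h' : (true : Bool) ≤ false := h
        exact absurd h' (by decide)
      · rcases p with ⟨i, hi⟩
        simp [allBlue] at hi
        refine ⟨⟨0, by simp⟩, ?_⟩
        exact Fin.ext (by simp only [toPath]; omega)
  | .pin, _, p, _ => p.elim
  | .absent, _, p, _ => p.elim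
  | .ser s t, x, p, h => by
      obtain ⟨p1, p2⟩ := p
      have h' := Prod.mk_le_mk.1 h
      obtain ⟨q1, e1⟩ := exists_toPath_of_le s x.1 p1 h'.1
      obtain ⟨q2, e2⟩ := exists_toPath_of_le t x.2 p2 h'.2
      exact ⟨(q1, q2), by simp only [toPath, e1, e2]⟩
  | .par s t, x, .inl p, h => by
      have h' := (Prod.mk_le_mk.1 h).1
      obtain ⟨q, e⟩ := exists_toPath_of_le s x.1 p h'
      exact ⟨.inl q, by simp only [toPath, e]⟩
  | .par s t, x, .inr p, h => by
      have h' := (Prod.mk_le_mk.1 h).2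
      obtain ⟨q, e⟩ := exists_toPath_of_le t x.2 p h'
      exact ⟨.inr q, by simp only [toPath, e]⟩

/-- the paths of a pattern are finitely many -/
instance (s : SP) : Fintype (Path s) := bluePathsFintype s (allBlue s)

/-- the blue paths of `x` are the paths of the pattern below `x` -/
noncomputable def bluePathsEquiv (s : SP) (x : s.Conf) : bluePaths s x ≃ {p : Path s // pathConf s p ≤ x} :=
  Equiv.ofBijective (fun q => ⟨toPath s x q, toPath_le s x q⟩)
    ⟨fun q q' h => toPath_injective s x (Subtype.ext_iff.1 h),
     fun ⟨p, hp⟩ => by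
      obtain ⟨q, hq⟩ := exists_toPath_of_le s x p hp
      exact ⟨q, Subtype.ext hq⟩⟩

/-- **the blue-path count is the number of paths below the configuration** -/
theorem card_bluePaths_eq_card_paths_le (s : SP) (x : s.Conf) :
    Fintype.card (bluePaths s x) = (Finset.univ.filter (fun p : Path s => pathConf s p ≤ x)).card := by
  rw [Fintype.card_congr (bluePathsEquiv s x), Fintype.card_subtype]

end Paths

section UpTail

variable (s : SP)

/-- the principal-upper-set tail count `#{x ≥ c : r ≥ a, b ≥ j}` (the tail of the pattern with the blue edges
of `c` pinned blue) -/
def upTail (c : s.Conf) (a j : ℕ) : ℕ :=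
  (Finset.univ.filter (fun x : s.Conf => c ≤ x ∧ a ≤ s.rLab x ∧ j ≤ s.bLab x)).card

/-- the tail count is the principal-upper-set tail of the bottom configuration -/
theorem upTail_allRed (a j : ℕ) : upTail s (allRed s) a j = tailCount s a j := by
  unfold upTail tailCount
  congr 1
  ext x
  simp only [Finset.mem_filter, Finset.mem_univ, true_and, allRed_le s x]

/-- **the per-path decomposition of the blue-path mass**: `P(a,j) = Σ_p #{x ≥ pathConf p : r ≥ a, b ≥ j}` -/
theorem tailPaths_eq_sum_upTail (a j : ℕ) :
    tailPaths s a j = ∑ p : Path s, upTail s (pathConf s p) a j := by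
  unfold tailPaths upTail
  simp only [card_bluePaths_eq_card_paths_le, Finset.card_filter]
  rw [Finset.sum_filter, Finset.sum_comm]
  refine Finset.sum_congr rfl (fun x _ => ?_)
  by_cases h1 : a ≤ s.rLab x ∧ j ≤ s.bLab x
  · simp only [h1, and_true, if_true]
  · simp only [h1, and_false, if_false, Finset.sum_const_zero]

/-- **(PM) from (PP′)**: if every principal upper set of a path configuration has the mirror-dominated tail,
so does the blue-path mass: `P(A,C) ≤ P(C,A)` -/
theorem tailPaths_le_mirror_of_upTail (A C : ℕ)
    (h : ∀ p : Path s, upTail s (pathConf s p) A C ≤ upTail s (pathConf s p) C A) :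
    tailPaths s A C ≤ tailPaths s C A := by
  rw [tailPaths_eq_sum_upTail, tailPaths_eq_sum_upTail]
  exact Finset.sum_le_sum (fun p _ => h p)

/-- **(PM) from the blue-pinned shift**: `P(A,C) ≤ P(A−1,C+1)` from the one-step shift on every path's upper set -/
theorem tailPaths_le_shift_of_upTail (A C : ℕ)
    (h : ∀ p : Path s, upTail s (pathConf s p) A C ≤ upTail s (pathConf s p) (A - 1) (C + 1)) :
    tailPaths s A C ≤ tailPaths s (A - 1) (C + 1) := by
  rw [tailPaths_eq_sum_upTail, tailPaths_eq_sum_upTail]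
  exact Finset.sum_le_sum (fun p _ => h p)

end UpTail

section Calculus

/-- the principal-upper-set tail of a series composition multiplies -/
theorem upTail_ser (s t : SP) (c : (SP.ser s t).Conf) (a j : ℕ) :
    upTail (SP.ser s t) c a j = upTail s c.1 a j * upTail t c.2 a j := by
  unfold upTail
  simp only [Finset.card_filter]
  rw [Finset.sum_mul_sum, ← Fintype.sum_prod_type']
  refine Finset.sum_congr rfl (fun x _ => ?_)
  have e : (c ≤ x ↔ c.1 ≤ x.1 ∧ c.2 ≤ x.2) := Prod.le_def
  simp only [SP.rLab, SP.bLab, serR, serB, le_min_iff, e]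
  by_cases h1 : c.1 ≤ x.1 <;> by_cases h2 : c.2 ≤ x.2 <;> simp only [h1, h2, true_and, false_and, if_false, zero_mul, mul_zero]
  split_ifs <;> omega

/-- the principal-upper-set tail of a parallel composition fibres over the second factor -/
theorem upTail_par (s t : SP) (c : (SP.par s t).Conf) (a j : ℕ) :
    upTail (SP.par s t) c a j
      = ∑ y : t.Conf, if c.2 ≤ y then upTail s c.1 (a - t.rLab y) (j - t.bLab y) else 0 := by
  have key : ∀ y : t.Conf, (if c.2 ≤ y then upTail s c.1 (a - t.rLab y) (j - t.bLab y) else 0)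
      = ∑ x : s.Conf, if c.2 ≤ y ∧ c.1 ≤ x ∧ a - t.rLab y ≤ s.rLab x ∧ j - t.bLab y ≤ s.bLab x then 1 else 0 := by
    intro y
    unfold upTail
    rw [Finset.card_filter]
    by_cases h : c.2 ≤ y
    · rw [if_pos h]
      refine Finset.sum_congr rfl (fun x _ => ?_)
      simp only [h, true_and]
    · rw [if_neg h]
      simp only [h, false_and, if_false, Finset.sum_const_zero]
  simp only [key]
  unfold upTail
  rw [Finset.card_filter, Finset.sum_comm, ← Fintype.sum_prod_type']
  refine Finset.sum_congr rfl (fun x _ => ?_)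
  have e : (c ≤ x ↔ c.1 ≤ x.1 ∧ c.2 ≤ x.2) := Prod.le_def
  simp only [SP.rLab, SP.bLab, parR, parB, e]
  by_cases h1 : c.1 ≤ x.1 <;> by_cases h2 : c.2 ≤ x.2 <;>
    simp only [h1, h2, true_and, false_and, and_false, if_false]
  split_ifs <;> omega

end Calculus

end Summit.Ventures.PercRepro2.Tail2D
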